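import Mathlib

/-! R5 sanity (planner sidea k2 g9): the two-rational-cusp shadow, UNIFORM in the binary form `F` —
a route-level strengthen-to-simplify suggestion (tenure planner), NOT a helper of `stub_splitCuspTriple`.
`a 0 = F(1,0)`, `a (Fin.last d) = F(0,1)`; the member-local identity is `F(u,w) - F(0,1)·w^d = u·G(u,w)`. -/

namespace SideaK2G9

/-- log max(|u|,|w|) ≤ κ_{F,ε} · rad(u·w·F(u,w))^ε · min(rad u, rad w) for every binary form F with
F(1,0)·F(0,1) ≠ 0 and all coprime u, w with u·w·F(u,w) ≠ 0. -/
def TwoRationalCuspShadow : Prop :=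
  ∀ (d : ℕ) (a : Fin (d + 1) → ℤ), a 0 ≠ 0 → a (Fin.last d) ≠ 0 → ∀ ε : ℝ, 0 < ε → ∃ κ : ℝ,
    ∀ u w : ℤ, IsCoprime u w →
    u * w * (∑ i : Fin (d + 1), a i * u ^ (d - (i : ℕ)) * w ^ (i : ℕ)) ≠ 0 →
    Real.log (max (|(u : ℝ)|) (|(w : ℝ)|)) ≤
      κ * (((UniqueFactorizationMonoid.radical
              (u * w * ∑ i : Fin (d + 1), a i * u ^ (d - (i : ℕ)) * w ^ (i : ℕ))).natAbs : ℕ) : ℝ) ^ (ε : ℝ) *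
        min ((((UniqueFactorizationMonoid.radical u).natAbs : ℕ) : ℝ))
            ((((UniqueFactorizationMonoid.radical w).natAbs : ℕ) : ℝ))

/-- The golden instance: `d = 2`, `a = ![1, -11, -1]` is the cusp quadratic of `X₁(5)`. -/
example (u w : ℤ) : (∑ i : Fin (2 + 1), (![1, -11, -1] : Fin 3 → ℤ) i * u ^ (2 - (i : ℕ)) * w ^ (i : ℕ))
    = u ^ 2 - 11 * u * w - w ^ 2 := by
  simp [Fin.sum_univ_three]
  ring

/-- The member-local identity behind `RouteU`, generic in `F`: `F(u,w) - F(0,1)·w^d ∈ u·ℤ[u,w]`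
(here only the golden case, which is the tree's `GoldenCuspShadowBaker.t0`). -/
example (u w : ℤ) : w ^ 2 + (u ^ 2 - 11 * u * w - w ^ 2) = u * (u - 11 * w) := by ring

end SideaK2G9
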